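import Summits.BirchSwinnertonDyer.BirchSwinnertonDyer.Theorems.KolyvaginRankRigidityAtTwoSwapPairingLowerBoundGlobal
import Summits.BirchSwinnertonDyer.BirchSwinnertonDyer.Theorems.KolyvaginRankRigidityAtTwoSwapKummerEigenLinesOfIndexAtTwo
import Summits.BirchSwinnertonDyer.BirchSwinnertonDyer.Theorems.KolyvaginRankRigidityAtTwoSwapAuxClassLagrangianSign
import HarnessLib

/-!
# Crux V2♭θ `KolyvaginCorankLowerBoundAtTwoTheta` (stmt-BirchSwinnertonDyer-27220), line
# `kolyvagin_depth_split`, inside of S1, piece **P5** (auxiliary class with size) — LOCAL PART at the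
# Kolyvagin prime being swapped out (helper, PROVED; seat `bsd-line-krr2-p2` g7)

`exists_conjActPlace_eigen_pow_smul_ne_zero_of_isotropic`: at the place `v` of a Zhang–Kolyvagin prime `a`
at `2` of index `≥ M + 1` (numerics only), fixed by the non-trivial automorphism `τ` of the imaginary
quadratic field `K`, every subgroup `A ≤ H¹(K_v, E[2^M])` that is stable under `σ_* = conjActPlace`,
isotropic for the local Tate pairing composed with the Weil transport, and of Lagrangian size
(`#H¹(K_v, E[2^M]) ≤ #A²`) contains, for each sign `s`, an `s`-eigenclass `x` of `σ_*` with
`2^{⌊(M−7)/2⌋} x ≠ 0`.  This is the abstract `LagrangianSign.exists_eigen_pow_smul_ne_zero_of_isotropic` fed with: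
perfectness of the local Tate pairing (`IsPerfect`) and bijectivity of the local Weil transport; the
`τ`-invariance `⟨σ_* x, w_v σ_* y⟩ = ⟨x, w_v y⟩` (`localTatePairingZMod_conjActPlace` + `map_weilDual_conjActPlace`,
inputs `IsConjCompatible` and a Weil datum equivariant under the adapted lift `liftAutPlace τ hfix`); the
self-duality `Kum_v = Kum_v^⊥` (`GaloisImage.dualTransported_kummerSelmerStructure_inr`); `Kum_v ≅ E[2^M](K̄)`
as a group (`Kum_v = H¹_ur`, seat g6's evaluation equivalence `exists_addEquiv_unramified_eval`), whence
`#Kum_v = 2^{2M}` and `#Kum_v[2^e] ≤ 2^{2e}`; and the eigen-LINES of `σ_*` on `Kum_v` from Zhang's numerics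
(`kummer_eigen_at_two_of_index`, this seat, index `≥ M + 1`) through `LagrangianSign.card_inf_torsion_le_of_line`.
The global part of P5 (the image of the relaxed Selmer group is such an `A`, by Poitou–Tate at one place)
is a separate file.  HONEST FRAMING: helper (`--supports` 27220); S1 / V2♭θ are NOT proved; BSD is not proved.

References: [cite: Kolyvagin1991MathAnn, §2 (proof of Thm. 2.2)] [cite: Jetchev2008, §3.2 (2), Lemma 5.2, §5 Thm. 5.1]
[cite: McCallumLMS1991, §4, §5 Prop. 5.2] [cite: MilneADT2006, Ch. I, Cor. 2.3].
-/

set_option autoImplicit false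
set_option linter.dupNamespace false

noncomputable section

open scoped Classical
open Function NumberField IsDedekindDomain WeierstrassCurve Field
open Literature.NumberTheory.EllipticCurves Literature.NumberTheory.GaloisRepresentations
open Literature.NumberTheory.GaloisCohomology
open Literature.NumberTheory.GaloisRepresentations.DiscreteGaloisModule (localTatePairingZMod tateDual
  SelmerStructure)
open Summit.BirchSwinnertonDyer.Rank1Residual
open Summit.BirchSwinnertonDyer.Rank1Residual.JET.GlobalDuality

namespace Summit.BirchSwinnertonDyer.BirchSwinnertonDyer.Theorems.KolyvaginLowerBoundAtTwo

variable {K : Type} [Field K] [NumberField K] (W : WeierstrassCurve ℚ) [W.IsElliptic]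
  [W.IsGloballyMinimal] [(W.baseChange K).IsElliptic]
  (τ : K ≃ₐ[ℚ] K) (M : ℕ) [NeZero (2 ^ M)] [Finite (geomTorsion (W.baseChange K) ((2 ^ M : ℕ) : ℤ))]
  (e : geomTorsion (W.baseChange K) ((2 ^ M : ℕ) : ℤ) → geomTorsion (W.baseChange K) ((2 ^ M : ℕ) : ℤ) →
    AlgebraicClosure K)
  (hμ : ∀ S T, e S T ^ (2 ^ M) = 1)
  (hadd₁ : ∀ S₁ S₂ T, e (S₁ + S₂) T = e S₁ T * e S₂ T)
  (hadd₂ : ∀ S T₁ T₂, e S (T₁ + T₂) = e S T₁ * e S T₂)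
  (hgal : ∀ (g : absoluteGaloisGroup K) (S T : geomTorsion (W.baseChange K) ((2 ^ M : ℕ) : ℤ)),
    g • e S T = e (g • S) (g • T))
  (halt : ∀ T, e T T = 1) (hnondeg : ∀ T, (∀ S, e S T = 1) → T = 0)
  (inv : LocalInvariants K (2 ^ M))

include halt hnondeg in
/-- **P5, local part: an `s`-eigenclass of order `≥ 2^{⌊(M−7)/2⌋}` in a `σ_*`-stable isotropic subgroup of
Lagrangian size of `H¹(K_v, E[2^M])`, at a numerically-Kolyvagin place of index `≥ M + 1`.**  See the file
docstring for the inputs. [cite: Kolyvagin1991MathAnn, §2 (proof of Thm. 2.2)] [cite: Jetchev2008, Lemma 5.2, §3.2 (2)]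
[cite: MilneADT2006, Ch. I, Cor. 2.3] -/
theorem exists_conjActPlace_eigen_pow_smul_ne_zero_of_isotropic (hK : IsImaginaryQuadratic K) (hM : 7 ≤ M)
    {a : ℕ} (ha : Zhang2014.IsKolyvaginPrime (W.conductorNorm ℤ) W K 2 a)
    (hMa : M + 1 ≤ Zhang2014.kolyvaginIndex W 2 a)
    (v : HeightOneSpectrum (𝓞 K)) (hv : ((a : ℕ) : 𝓞 K) ∈ v.asIdeal) (hτ1 : τ ≠ 1) (hττ : τ * τ = 1)
    (hfix : τ • v = v)
    (hτe : ∀ S T, liftAutPlace τ hfix (e S T) =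
      e ((isLiftOfAut_liftAutPlace τ hfix).torsionMap W ((2 ^ M : ℕ) : ℤ) S)
        ((isLiftOfAut_liftAutPlace τ hfix).torsionMap W ((2 ^ M : ℕ) : ℤ) T))
    (hperf : inv.IsPerfect) (hinvc : inv.IsConjCompatible τ)
    (A : AddSubgroup (galoisCohomology
      (((W.baseChange K).torsionGaloisModule ((2 ^ M : ℕ) : ℤ)).toLocal (Sum.inr v : Place K)) 1))
    (hAτ : ∀ x ∈ A, conjActPlace W τ ((2 ^ M : ℕ) : ℤ) hfix x ∈ A)
    (hAA : ∀ x ∈ A, ∀ y ∈ A,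
      localTatePairingZMod ((W.baseChange K).torsionGaloisModule ((2 ^ M : ℕ) : ℤ)) (2 ^ M)
        (Sum.inr v : Place K) (inv (Sum.inr v)) x
        (galoisCohomology.map ((weilDualIntertwining (W.baseChange K) (2 ^ M) e hμ hadd₁ hadd₂ hgal).restrictField
          (v.adicCompletion K)) 1 y) = 0)
    (hA : Nat.card (galoisCohomology
        (((W.baseChange K).torsionGaloisModule ((2 ^ M : ℕ) : ℤ)).toLocal (Sum.inr v : Place K)) 1) ≤
      Nat.card A * Nat.card A)
    {s : ℤ} (hs : s = 1 ∨ s = -1) :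
    ∃ x ∈ A, conjActPlace W τ ((2 ^ M : ℕ) : ℤ) hfix x = s • x ∧ (2 : ℤ) ^ ((M - 7) / 2) • x ≠ 0 := by
  classical
  haveI : Fact (Nat.Prime 2) := ⟨Nat.prime_two⟩
  haveI : CharZero (v.adicCompletion K) :=
    charZero_of_injective_algebraMap (algebraMap K (v.adicCompletion K)).injective
  have hM1 : 1 ≤ M := by omega
  have hNpow : IsPrimePow (2 ^ M) := ⟨2, M, Nat.prime_two.prime, hM1, rfl⟩
  -- notation
  have e2 : ∀ n : ℕ, ((2 ^ n : ℕ) : ℤ) = (2 : ℤ) ^ n := fun n ↦ by norm_num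
  set P := localTatePairingZMod ((W.baseChange K).torsionGaloisModule ((2 ^ M : ℕ) : ℤ)) (2 ^ M) (Sum.inr v : Place K) (inv (Sum.inr v)) with hP
  set g := galoisCohomology.map ((weilDualIntertwining (W.baseChange K) (2 ^ M) e hμ hadd₁ hadd₂ hgal).restrictField
      (v.adicCompletion K)) 1 with hg
  set σ := conjActPlace W τ ((2 ^ M : ℕ) : ℤ) hfix with hσ
  haveI : Finite (galoisCohomology (((W.baseChange K).torsionGaloisModule ((2 ^ M : ℕ) : ℤ)).toLocal (Sum.inr v : Place K)) 1) :=
    finite_galoisCohomology_one_toLocal ((W.baseChange K).torsionGaloisModule ((2 ^ M : ℕ) : ℤ)) v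
  -- `2^M` kills everything
  have hMtor : ∀ Q : geomTorsion (W.baseChange K) ((2 ^ M : ℕ) : ℤ), (2 ^ M) • Q = 0 := fun Q ↦ by
    simpa using (W.baseChange K).natAbs_nsmul_geomTorsion Q
  have hH : ∀ x : galoisCohomology (((W.baseChange K).torsionGaloisModule ((2 ^ M : ℕ) : ℤ)).toLocal (Sum.inr v : Place K)) 1, (2 ^ M) • x = 0 := fun x ↦
    galoisCohomology.nsmul_eq_zero_of_forall (((W.baseChange K).torsionGaloisModule ((2 ^ M : ℕ) : ℤ)).toLocal (Sum.inr v : Place K)) hMtor x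
  -- the pairing `b(x, y) = ⟨x, w_v y⟩`
  set b : galoisCohomology (((W.baseChange K).torsionGaloisModule ((2 ^ M : ℕ) : ℤ)).toLocal (Sum.inr v : Place K)) 1 →+
      galoisCohomology (((W.baseChange K).torsionGaloisModule ((2 ^ M : ℕ) : ℤ)).toLocal (Sum.inr v : Place K)) 1 →+ ZMod (2 ^ M) := P.compl₂ g with hb
  have hbapply : ∀ x y, b x y = P x (g y) := fun x y => rfl
  -- `b.flip` is bijective: `P.flip` is (local duality) and `g = w_v` is
  have hg_bij : Bijective g := by
    refine ⟨X11b.LocBridge.map_weilDual_restrictField_injective (W.baseChange K) (2 ^ M) e hμ hadd₁ hadd₂ hgal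
      hnondeg (v.adicCompletion K), fun y => ⟨galoisCohomology.map ((X11b.LocBridge.weilDualInv (W.baseChange K)
        (2 ^ M) e hμ hadd₁ hadd₂ hgal hnondeg).restrictField (v.adicCompletion K)) 1 y, ?_⟩⟩
    exact X11b.LocBridge.map_weilDual_map_weilDualInv_restrictField (W.baseChange K) (2 ^ M) e hμ hadd₁ hadd₂
      hgal hnondeg (v.adicCompletion K) y
  have hb' : Bijective b.flip := by
    have hflip : ⇑b.flip = ⇑P.flip ∘ ⇑g := by
      funext y; ext x; rfl
    rw [hflip]
    exact ((hperf v).2 ((W.baseChange K).torsionGaloisModule ((2 ^ M : ℕ) : ℤ)) hMtor).2.comp hg_bij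
  -- `σ_*` is an involution and `b` is `σ_*`-invariant
  have hσσ : ∀ x, σ (σ x) = x := fun x => conjActPlace_conjActPlace W τ ((2 ^ M : ℕ) : ℤ) hττ hfix hfix x
  have hgσ : ∀ y, g (σ y) = conjActPlaceDual W τ ((2 ^ M : ℕ) : ℤ) (2 ^ M) hfix (g y) := fun y =>
    map_weilDual_conjActPlace W τ (2 ^ M) e hμ hadd₁ hadd₂ hgal hfix hτe y
  have hbσ : ∀ x y, b (σ x) (σ y) = b x y := fun x y => by
    rw [hbapply, hbapply, hgσ]
    exact localTatePairingZMod_conjActPlace W τ ((2 ^ M : ℕ) : ℤ) (N := 2 ^ M) inv hinvc hfix x (g y)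
  -- `Kum_v` is `σ_*`-stable and self-annihilating
  have hKσ : ∀ x ∈ ((W.baseChange K).kummerSelmerStructure ((2 ^ M : ℕ) : ℤ) (Sum.inr v : Place K)), σ x ∈ ((W.baseChange K).kummerSelmerStructure ((2 ^ M : ℕ) : ℤ) (Sum.inr v : Place K)) := fun x hx => conjActPlace_mem_kummerSelmerStructure W τ _ hfix hx
  have hKK : ∀ x, x ∈ ((W.baseChange K).kummerSelmerStructure ((2 ^ M : ℕ) : ℤ) (Sum.inr v : Place K)) ↔ ∀ y ∈ ((W.baseChange K).kummerSelmerStructure ((2 ^ M : ℕ) : ℤ) (Sum.inr v : Place K)), b y x = 0 := by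
    intro x
    have hsd := GaloisImage.dualTransported_kummerSelmerStructure_inr (W.baseChange K) (2 ^ M) e hμ hadd₁
      hadd₂ hgal halt hnondeg hNpow v (localEulerPoincareCharacteristic_holds (v.adicCompletion K)) inv
      ((hperf v).1.injective)
    have h1 : x ∈ ((W.baseChange K).kummerSelmerStructure ((2 ^ M : ℕ) : ℤ) (Sum.inr v : Place K)) ↔ x ∈ inv.dualTransported ((W.baseChange K).kummerSelmerStructure ((2 ^ M : ℕ) : ℤ))
        (weilDualIntertwining (W.baseChange K) (2 ^ M) e hμ hadd₁ hadd₂ hgal) (Sum.inr v) := by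
      rw [hsd]
    rw [h1, LocalInvariants.mem_dualTransported_iff, LocalInvariants.dualSelmerStructure_apply,
      LocalInvariants.mem_dualLocalCondition_iff]
    exact Iff.rfl
  -- ### `Kum_v ≅ E[2^M](K̄)` as a group: `#Kum_v = 2^(2M)` and `#Kum_v[2^e] ≤ 2^(2e)`
  obtain ⟨hgood, hpv⟩ := hasGoodReductionAt_of_zhangKolyvaginPrime W K ha v hv 1
  have hpv' : ((2 : ℕ) : 𝓞 K) ∉ v.asIdeal := by rwa [pow_one, Int.cast_natCast] at hpv
  have hKumEq : ((W.baseChange K).kummerSelmerStructure ((2 ^ M : ℕ) : ℤ) (Sum.inr v : Place K)) = DiscreteGaloisModule.unramifiedSubgroup (GaloisRep.toLocal v ((W.baseChange K).torsionGaloisModule ((2 ^ M : ℕ) : ℤ))) 1 := by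
    rw [X11b.KummerPT.kummerSelmerStructure_inr_eq_unramifiedSubgroup (W.baseChange K) 2 M hpv' hgood]
  obtain ⟨φ, hφ⟩ := exists_isAbsArithFrob_holds (v.adicCompletion K)
  have hφ1 : IsFrobPow φ 1 := IsAbsArithFrob.isFrobPow_holds hφ
  obtain ⟨eK, -, -⟩ := exists_addEquiv_unramified_eval (GaloisRep.toLocal v ((W.baseChange K).torsionGaloisModule ((2 ^ M : ℕ) : ℤ)))
    (galoisRep_toLocal_apply_eq_self W K hK ha (Nat.le_of_succ_le hMa) v hv) hφ1
    (AddMonoidHom.id _) (AddMonoidHom.id _) id (fun ψ => ⟨ψ, rfl, fun _ => rfl⟩) hφ1 (fun _ h => h)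
  -- transport the evaluation equivalence to `((W.baseChange K).kummerSelmerStructure ((2 ^ M : ℕ) : ℤ) (Sum.inr v : Place K))` (literally equal to `H¹_ur`)
  have eK' : ((W.baseChange K).kummerSelmerStructure ((2 ^ M : ℕ) : ℤ) (Sum.inr v : Place K)) ≃+ geomTorsion (W.baseChange K) ((2 ^ M : ℕ) : ℤ) := (AddEquiv.addSubgroupCongr hKumEq).trans eK
  have hcardT : ∀ n : ℕ, Nat.card (geomTorsion (W.baseChange K) ((2 ^ n : ℕ) : ℤ)) = 2 ^ (2 * n) := fun n => by
    rw [mul_comm, pow_mul]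
    exact card_torsionPoints_eq_sq_holds (W.baseChange K) (AlgebraicClosure K) (n := 2 ^ n)
      (by exact_mod_cast pow_ne_zero n two_ne_zero)
  have hKcard : Nat.card ((W.baseChange K).kummerSelmerStructure ((2 ^ M : ℕ) : ℤ) (Sum.inr v : Place K)) = 2 ^ (2 * M) := by
    rw [← hcardT M]
    exact Nat.card_congr eK'.toEquiv
  have hKtors : ∀ n : ℕ, Nat.card (((W.baseChange K).kummerSelmerStructure ((2 ^ M : ℕ) : ℤ) (Sum.inr v : Place K)) ⊓ ((2 : ℤ) ^ n • AddMonoidHom.id _).ker : AddSubgroup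
      (galoisCohomology (((W.baseChange K).torsionGaloisModule ((2 ^ M : ℕ) : ℤ)).toLocal (Sum.inr v : Place K)) 1)) ≤ 2 ^ (2 * n) := by
    intro n
    rcases le_or_gt M n with hMn | hnM
    · calc _ ≤ Nat.card ((W.baseChange K).kummerSelmerStructure ((2 ^ M : ℕ) : ℤ) (Sum.inr v : Place K)) := Nat.card_le_card_of_injective _ (AddSubgroup.inclusion_injective inf_le_left)
        _ = 2 ^ (2 * M) := hKcard
        _ ≤ 2 ^ (2 * n) := Nat.pow_le_pow_right (by norm_num) (by omega)
    haveI : Finite (geomTorsion (W.baseChange K) ((2 ^ n : ℕ) : ℤ)) :=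
      finite_torsionPoints_holds (W.baseChange K) (AlgebraicClosure K) (by positivity)
    -- the map `x ↦ eK' x` on `Kum_v[2^n]`, with values in `E[2^n]` (orders are preserved)
    have hval : ∀ x : (((W.baseChange K).kummerSelmerStructure ((2 ^ M : ℕ) : ℤ) (Sum.inr v : Place K)) ⊓ ((2 : ℤ) ^ n • AddMonoidHom.id _).ker : AddSubgroup
        (galoisCohomology (((W.baseChange K).torsionGaloisModule ((2 ^ M : ℕ) : ℤ)).toLocal (Sum.inr v : Place K)) 1)),
        ((eK' (AddSubgroup.inclusion inf_le_left x) : geomTorsion (W.baseChange K) ((2 ^ M : ℕ) : ℤ)) :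
          geomPoints (W.baseChange K)) ∈ geomTorsion (W.baseChange K) ((2 ^ n : ℕ) : ℤ) := by
      intro x
      have h2 : (2 : ℤ) ^ n • (x.1 : galoisCohomology (((W.baseChange K).torsionGaloisModule ((2 ^ M : ℕ) : ℤ)).toLocal (Sum.inr v : Place K)) 1) = 0 := by
        have h := (AddSubgroup.mem_inf.mp x.2).2
        rwa [AddMonoidHom.mem_ker, AddMonoidHom.smul_apply, AddMonoidHom.id_apply] at h
      have h2n : (2 ^ n) • (x.1 : galoisCohomology (((W.baseChange K).torsionGaloisModule ((2 ^ M : ℕ) : ℤ)).toLocal (Sum.inr v : Place K)) 1) = 0 :=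
        ((natCast_zsmul _ (2 ^ n)).symm.trans (congrArg (fun z : ℤ => z • (x.1 : galoisCohomology
          (((W.baseChange K).torsionGaloisModule ((2 ^ M : ℕ) : ℤ)).toLocal (Sum.inr v : Place K)) 1)) (e2 n))).trans h2
      have hord : addOrderOf ((eK' (AddSubgroup.inclusion inf_le_left x) :
          geomTorsion (W.baseChange K) ((2 ^ M : ℕ) : ℤ)) : geomPoints (W.baseChange K)) ∣ 2 ^ n := by
        rw [AddSubgroup.addOrderOf_coe, AddEquiv.addOrderOf_eq, ← AddSubgroup.addOrderOf_coe,
          AddSubgroup.coe_inclusion]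
        exact addOrderOf_dvd_of_nsmul_eq_zero h2n
      rw [mem_geomTorsion_iff, natCast_zsmul]
      exact addOrderOf_dvd_iff_nsmul_eq_zero.mp hord
    have hf : Injective (fun x : (((W.baseChange K).kummerSelmerStructure ((2 ^ M : ℕ) : ℤ) (Sum.inr v : Place K)) ⊓ ((2 : ℤ) ^ n • AddMonoidHom.id _).ker : AddSubgroup
        (galoisCohomology (((W.baseChange K).torsionGaloisModule ((2 ^ M : ℕ) : ℤ)).toLocal (Sum.inr v : Place K)) 1)) =>
        (⟨_, hval x⟩ : geomTorsion (W.baseChange K) ((2 ^ n : ℕ) : ℤ))) := by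
      intro x y hxy
      have h1 := congrArg Subtype.val hxy
      exact AddSubgroup.inclusion_injective inf_le_left (eK'.injective (Subtype.ext h1))
    calc _ ≤ Nat.card (geomTorsion (W.baseChange K) ((2 ^ n : ℕ) : ℤ)) := Nat.card_le_card_of_injective _ hf
      _ = 2 ^ (2 * n) := hcardT n
  -- ### the eigen-LINES of `σ_*` on `Kum_v` (brick B from the numerics, index `≥ M + 1`)
  have hH' : ∀ x : galoisCohomology (((W.baseChange K).torsionGaloisModule ((2 ^ M : ℕ) : ℤ)).toLocal (Sum.inr v : Place K)) 1, (2 : ℤ) ^ M • x = 0 := fun x =>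
    ((congrArg (fun z : ℤ => z • x) (e2 M)).symm.trans (natCast_zsmul x (2 ^ M))).trans (hH x)
  have hKline : ∀ ε : ℤ, ε = 1 ∨ ε = -1 → ∀ n : ℕ,
      Nat.card (((W.baseChange K).kummerSelmerStructure ((2 ^ M : ℕ) : ℤ) (Sum.inr v : Place K)) ⊓ (σ - ε • AddMonoidHom.id _).ker ⊓ ((2 : ℤ) ^ n • AddMonoidHom.id _).ker : AddSubgroup
        (galoisCohomology (((W.baseChange K).torsionGaloisModule ((2 ^ M : ℕ) : ℤ)).toLocal (Sum.inr v : Place K)) 1)) ≤ 2 ^ (n + 1) := by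
    intro ε hε n
    obtain ⟨hcount, c, hcmem, hcne⟩ := kummer_eigen_at_two_of_index W K hK hM1 ha hMa v hv hτ1 hfix hε
    have hcne' : (2 : ℤ) ^ (M - 1) • c ≠ 0 := fun h0 =>
      hcne ((natCast_zsmul c (2 ^ (M - 1))).symm.trans ((congrArg (fun z : ℤ => z • c) (e2 (M - 1))).trans h0))
    exact LagrangianSign.card_inf_torsion_le_of_line _ hcount hcmem (hH' c) hcne' hM1 n
  -- ### the abstract count
  obtain ⟨x, hxA, hx, hne⟩ := LagrangianSign.exists_eigen_pow_smul_ne_zero_of_isotropic hH b hb' σ hσσ hbσ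
    ((W.baseChange K).kummerSelmerStructure ((2 ^ M : ℕ) : ℤ) (Sum.inr v : Place K)) hKσ hKK hM hKcard hKtors hKline A hAτ (fun x hx y hy => hAA x hx y hy) hA hs
  exact ⟨x, hxA, hx, hne⟩

end Summit.BirchSwinnertonDyer.BirchSwinnertonDyer.Theorems.KolyvaginLowerBoundAtTwo

end
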